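import Literature.NumberTheory.EllipticCurves.PeriodIndexThm2Reduction
import HarnessLib

/-!
# Clark–Sharif's Theorem 2 ⇐ `I ∣ P²` and the corestricted Kummer classes (fact split)

Topic `NumberTheory/EllipticCurves`. Fact-decomposition file (librarian, mode `fact-decompose`,
2026-08-16) for the named fact `Literature.NumberTheory.EllipticCurves.ClarkSharif2010_thm2`
(`PeriodIndex.lean`; P. L. Clark, S. Sharif, *Period, index and potential Ш*, Algebra & Number
Theory 4 (2010) 151–174 = arXiv:0811.3019, **Theorem 2**: for an elliptic curve `E` over a number
field `K`, `P ≥ 1` and a finite set of places `S_K`, an infinite sequence `η_i ∈ H¹(K, E)`,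
`η_0 = 0`, locally trivial at `S_K`, with `η_i − η_j` of period `P` and index `P²` for `i ≠ j`).

The tree has PROVED the skeleton of the printed proof (§3): the standard trick reducing to prime
powers and the period step of §3.6 ¶1 (`ClarkSharif2010_thm2_of_primePow_torsion_index`,
`PeriodIndexProofs.lean`), the level field `K_P` (§3.3, `PeriodIndexLevelField.lean`), the
corestriction and the Kummer classes `Φ(a, b)` with their `P`-torsion and local triviality
(§3.2, §3.5; `PeriodIndexCorestriction*.lean`, `PeriodIndexKummerPhi*.lean`,
`PeriodIndexLocalTriviality.lean`), assembled as `ClarkSharif2010_thm2_of_kummerClasses hIP h`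
(`PeriodIndexThm2Reduction.lean`); and, towards its hypothesis `h`, the Brauer-free index
computation "`I(ξ_i − ξ_j) = P²`" from per-prime Kummer data (§3.6 with Cor. 17, Lemmas 18–19:
`PeriodIndexTwistedOrbitSums.lean`, `…DecompositionIndex.lean`, `…GlobalIndex.lean`,
`…FrobeniusTorsion.lean`, `…KummerIndex*.lean`: `index_sub_eq_sq_of_kummerData`) and the
inertia / congruence bridges (`…KummerInertiaOnto.lean`, `…KummerCongruence.lean`).

This file NAMES the two hypotheses of `ClarkSharif2010_thm2_of_kummerClasses` — two distinct
printed inputs — and records the PROVED assembly: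

* `ClarkSharif2010_index_dvd_period_sq` — **`I ∣ P²`** for classes of `H¹(K, E)` of an elliptic
  curve over a number field (Clark–Sharif §1.3 (1): "It is well known (e.g, [WCII]) that the
  period `P` and the index `I` of `C` satisfy the divisibilities `P ∣ I ∣ P²`"; Lang–Tate 1958,
  Cassels 1962, Lichtenbaum 1968; O'Neil's period-index obstruction).  The input of the period
  step (§3.6 ¶1).
* `ClarkSharif2010_kummerClasses_exist` — **§§3.3–3.6 of the printed proof**: for every elliptic
  curve `E/K`, prime power `P` and finite sets of places `S`, `T`, a level field `k = K_P` with a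
  basis `ρ` of `E[P]` and Kummer pairs `(a_i, b_i) ∈ kˣ × kˣ` (Lemma 14, by class field theory
  and the Chebotarev density theorem) which are `P`-th powers in all completions of `k` above
  `S ∪ T` ((SC1′), (SC3′)) and whose corestricted classes `η_i = cores_{k/K} Φ(a_i, b_i)` have
  pairwise differences of index `P²` ((SC2′), (SC4′), (SC5′), Lemmas 18–19, §3.6).  By the tree's
  `index_sub_eq_sq_of_kummerData` the index clause follows from per-prime data, so what this
  child really asks for is Lemma 14 (existence of the primes and pairs), the Galois form of
  (SC2′), and the local `P`-th power conditions at the prescribed places.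
* `ClarkSharif2010_thm2_holds_of` — PROVED: the two children give `ClarkSharif2010_thm2`
  (`ClarkSharif2010_thm2_of_kummerClasses`).

Neither child restates the parent: the first is a divisibility for ALL classes of `H¹(K, E)`,
the second an existence statement about Kummer classes over the level field (no period clause,
prime powers only).  Both are the hypotheses `hIP`, `h` of the accepted reduction verbatim.

## References

* P. L. Clark, S. Sharif, Algebra & Number Theory 4 (2010) 151–174 (arXiv:0811.3019): §1.3 (1),
  Theorem 2, §§3.3–3.6 (Lemma 14, Cor. 17, Lemmas 18–19). [ClarkSharif2010]
* P. L. Clark, J. Number Theory 114 (2005) 193–208, §2 (O'Neil's obstruction map). [Clark2005WCI]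
* S. Lang, J. Tate, Amer. J. Math. 80 (1958) 659–684. [LangTate1958]
-/

noncomputable section

open scoped Classical NumberField

universe u

namespace Literature.NumberTheory.EllipticCurves

open GaloisRepresentations Field NumberField IsDedekindDomain

/-- **`I ∣ P²` on `H¹(K, E)`** (Clark–Sharif 2010, §1.3 (1): "Let `C` be a genus one curve over an
arbitrary field `K`. It is well known (e.g, [WCII]) that the period `P` and the index `I` of `C`
satisfy the divisibilities `P ∣ I ∣ P²`"), vendored for elliptic curves over number fields in the
tree's vocabulary: for every class `η ∈ H¹(K, E) = W.galH1`, the index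
`Literature.NumberTheory.EllipticCurves.index W η` (gcd of the splitting degrees) divides
`(addOrderOf η)²`, the square of the period.  (Printed proofs: O'Neil's period–index obstruction
`Δ_P : H¹(K, E[P]) → Br(K)[P]` — a lift `ξ` of `η` is split by any extension splitting the
central simple algebra `Δ_P(ξ)` of period dividing `P`, hence by one of degree `P · P'`,
`P' ∣ P`, over a number field where period equals index in `Br`; Clark 2005 WCI §2, [WCII];
originally Lang–Tate 1958 and Cassels 1962.)  `P ∣ I` is the tree's
`index_dvd_of_mem_splittingDegrees` bookkeeping and is not restated.  This is the hypothesis `hIP`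
of `ClarkSharif2010_thm2_of_primePow_torsion_index` / `ClarkSharif2010_thm2_of_kummerClasses`,
verbatim. [cite: ClarkSharif2010, §1.3 (1)] [cite: Clark2005WCI, §2] -/
def ClarkSharif2010_index_dvd_period_sq : Prop :=
  ∀ {K : Type u} [Field K] [NumberField K] (W : WeierstrassCurve K) [W.IsElliptic]
    (η : W.galH1), index W η ∣ addOrderOf η ^ 2

/-- **Clark–Sharif 2010, §§3.3–3.6: the corestricted Kummer classes of the proof of Theorem 2
exist.**  For every elliptic curve `W/K` over a number field, every prime power `P = pⁿ`
(`n ≥ 1`) and finite sets `S`, `T` of finite and infinite places of `K`, there are: an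
intermediate field `K ⊆ k ⊆ K̄` with `𝔤_k = fixingGal k` open, normal and of finite index,
acting trivially on `E[P]`, and a primitive `P`-th root of unity `ζ ∈ k` (§3.3, the level field
`K_P = K(E[P*])` — in the tree `exists_levelField`); an additive `ρ : (ℤ/P)² → E[P]` (a basis);
and sequences `a, b : ℕ → kˣ` (§3.4, Lemma 14: `(a_i, b_i) = (π_i, π_i')` or `(π_i, 1)` for
principal primes `v_i = (π_i)`, `v_i' = (π_i')` of `k` chosen inductively by the Chebotarev
density theorem subject to (SC1′)–(SC5′)) such that (i) for every `v ∈ S` (resp. `w ∈ T`) and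
every `g ∈ 𝔤_K`, `ι(g a_i)` and `ι(g b_i)` are `P`-th powers in the composite field
`K_v(ι(g k)) ⊆ K̄_v` (resp. `K_w(ι(g k))`), `ι = closureEmb` — i.e. `a_i, b_i ∈ k_u^{×P}` for all
places `u` of `k` above `S ∪ T` ((SC1′), (SC3′) with `S` in the modulus) — and (ii) for `i ≠ j`
the class `η_i − η_j`, `η_i = (E[P] ⊂ E)_* cores_{k/K} Φ(a_i, b_i) ∈ H¹(K, E)` (`coresH1`,
`kummerPhi`), has index `P²` ((SC2′), (SC4′), (SC5′); Cor. 17, Lemmas 18–19 and §3.6 — in the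
tree reduced to per-prime Kummer data by `index_sub_eq_sq_of_kummerData`, with the bridges
`exists_mem_inertia_unitChar_eq` and `unitChar_eq_zero_of_mem_decompositionSubgroup_of_congr`).
This is the hypothesis `h` of the tree's `ClarkSharif2010_thm2_of_kummerClasses`, verbatim.
[cite: ClarkSharif2010, §§3.3–3.6 (Lemma 14, Cor. 17, Lemmas 18–19)] -/
def ClarkSharif2010_kummerClasses_exist : Prop :=
  ∀ {K : Type u} [Field K] [NumberField K] (W : WeierstrassCurve K) [W.IsElliptic]
    (P : ℕ) [NeZero P], (∃ p n : ℕ, p.Prime ∧ 0 < n ∧ P = p ^ n) →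
      ∀ (S : Finset (HeightOneSpectrum (𝓞 K))) (T : Finset (InfinitePlace K)),
      ∃ (k : IntermediateField K (AlgebraicClosure K))
        (hN : IsOpen (fixingGal k : Set (absoluteGaloisGroup K)))
        (_ : (fixingGal k).Normal) (_ : Fintype (absoluteGaloisGroup K ⧸ fixingGal k))
        (ζ : AlgebraicClosure K) (hζ : IsPrimitiveRoot ζ P) (hζk : ζ ∈ k)
        (htriv : ∀ (g : fixingGal k) (m : ↥(WeierstrassCurve.geomTorsion W (P : ℤ))),
          g • m = m)
        (ρ : ZMod P × ZMod P →+ ↥(WeierstrassCurve.geomTorsion W (P : ℤ)))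
        (a b : ℕ → (↥k)ˣ),
        (∀ i, ∀ v ∈ S, ∀ g : absoluteGaloisGroup K,
          (∃ r ∈ IntermediateField.adjoin (v.adicCompletion K)
              ((fun y : AlgebraicClosure K ↦ closureEmb (K := K) (v.adicCompletion K) (g • y)) ''
                (k : Set (AlgebraicClosure K))),
            r ^ P = closureEmb (K := K) (v.adicCompletion K)
              (g • ((a i : k) : AlgebraicClosure K))) ∧
          (∃ r ∈ IntermediateField.adjoin (v.adicCompletion K)
              ((fun y : AlgebraicClosure K ↦ closureEmb (K := K) (v.adicCompletion K) (g • y)) ''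
                (k : Set (AlgebraicClosure K))),
            r ^ P = closureEmb (K := K) (v.adicCompletion K)
              (g • ((b i : k) : AlgebraicClosure K)))) ∧
        (∀ i, ∀ w ∈ T, ∀ g : absoluteGaloisGroup K,
          (∃ r ∈ IntermediateField.adjoin w.Completion
              ((fun y : AlgebraicClosure K ↦ closureEmb (K := K) w.Completion (g • y)) ''
                (k : Set (AlgebraicClosure K))),
            r ^ P = closureEmb (K := K) w.Completion (g • ((a i : k) : AlgebraicClosure K))) ∧
          (∃ r ∈ IntermediateField.adjoin w.Completion
              ((fun y : AlgebraicClosure K ↦ closureEmb (K := K) w.Completion (g • y)) ''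
                (k : Set (AlgebraicClosure K))),
            r ^ P = closureEmb (K := K) w.Completion (g • ((b i : k) : AlgebraicClosure K)))) ∧
        ∀ i j, i ≠ j →
          index W
            (resH1Hom (ContinuousMonoidHom.id (absoluteGaloisGroup K))
                (WeierstrassCurve.geomTorsion W (P : ℤ)).subtype (geomTorsion_subtype_smul W P)
                (coresH1 (fixingGal k) hN (kummerPhi hζ hζk htriv ρ (a i) (b i))) -
              resH1Hom (ContinuousMonoidHom.id (absoluteGaloisGroup K))
                (WeierstrassCurve.geomTorsion W (P : ℤ)).subtype (geomTorsion_subtype_smul W P)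
                (coresH1 (fixingGal k) hN (kummerPhi hζ hζk htriv ρ (a j) (b j)))) =
            P ^ 2

/-- **Assembly (fact split): Clark–Sharif's Theorem 2 from `I ∣ P²` and the Kummer classes** —
the tree's `ClarkSharif2010_thm2_of_kummerClasses` (standard trick, period step, local
triviality and `P`-torsion of the corestricted Kummer classes, all proved).
[cite: ClarkSharif2010, Theorem 2, §3 and §§3.3–3.6] -/
theorem ClarkSharif2010_thm2_holds_of (hIP : ClarkSharif2010_index_dvd_period_sq.{u})
    (h : ClarkSharif2010_kummerClasses_exist.{u}) : ClarkSharif2010_thm2.{u} :=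
  ClarkSharif2010_thm2_of_kummerClasses hIP h

end Literature.NumberTheory.EllipticCurves

end
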